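import Mathlib
import Summits.KontsevichZagierPeriods.Zeta5Search.Families.RayGrowth
import HarnessLib

/-!
# ζ(5) search — Families: the growth constant is log-convex and positively homogeneous in the direction

HONEST FRAMING: systematic search; no irrationality claim unless certified.  STRUCTURAL facts about the growth
constants `M_σ(α,β) = sup_S f_σ(α,β)` (`raySup`, `Families/RayGrowth.lean`) of Brown's generalised cellular families
[Brown2016, §1.5, §5.1–5.2]; nothing about the arithmetic of any zeta value.  Seat P2, Families layer.

As a function of the exponent direction `(α, β)` (finite factors, on the open simplex):
* `rayF_add` — `f_σ(α+α', β+β') = f_σ(α,β) · f_σ(α',β')` and `rayF_smul` — `f_σ(kα,kβ) = f_σ(α,β)^k`;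
* **`raySup_add_le`** — `M_σ(α+α', β+β') ≤ M_σ(α,β) · M_σ(α',β')` whenever both factors are bounded on the simplex
  (SUBMULTIPLICATIVITY: `log M_σ` is subadditive in the direction);
* **`raySup_smul`** — `M_σ(kα, kβ) = M_σ(α,β)^k` for `k ≥ 1` (POSITIVE HOMOGENEITY);
so the decay exponent `c_σ(α,β) = −log M_σ(α,β)` of a cellular family is a superadditive, positively homogeneous —
hence CONCAVE — function of the direction on Brown's convergence cone (`decayExp_superadditive`, `decayExp_smul`):
along a segment of directions the decay exponent is at least the linear interpolation of its endpoint values.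
Standard axioms only.
-/

noncomputable section

open MeasureTheory Set Finset Filter Topology

namespace Summit.KontsevichZagierPeriods.Zeta5Search.Families.Cellular

variable {ℓ : ℕ} (σ : Fin (ℓ + 3) → Fin (ℓ + 3)) (α β α' β' : Fin (ℓ + 3) → ℤ)

/-! ### Algebra of the ray function in the direction -/

/-- `f_σ(α+α', β+β') = f_σ(α,β) · f_σ(α',β')` on the open simplex (injective `σ`). -/
theorem rayF_add (hσi : Function.Injective σ) {t : Fin ℓ → ℝ} (ht : t ∈ openSimplex ℓ) :
    rayF σ (fun i => α i + α' i) (fun i => β i + β' i) t = rayF σ α β t * rayF σ α' β' t := by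
  unfold rayF num den
  have hnum : ∏ i : Fin (ℓ + 3), ef t i (i + 1) ^ (α i + α' i) =
      (∏ i : Fin (ℓ + 3), ef t i (i + 1) ^ α i) * ∏ i : Fin (ℓ + 3), ef t i (i + 1) ^ α' i := by
    rw [← Finset.prod_mul_distrib]
    exact Finset.prod_congr rfl fun i _ => zpow_add₀ (ef_pos ht (succ_ne_self i)).ne' _ _
  have hden : ∏ i : Fin (ℓ + 3), ef t (σ i) (σ (i + 1)) ^ (β i + β' i) =
      (∏ i : Fin (ℓ + 3), ef t (σ i) (σ (i + 1)) ^ β i) * ∏ i : Fin (ℓ + 3), ef t (σ i) (σ (i + 1)) ^ β' i := by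
    rw [← Finset.prod_mul_distrib]
    exact Finset.prod_congr rfl fun i _ => zpow_add₀ (ef_pos ht fun e => succ_ne_self i (hσi e)).ne' _ _
  dsimp only
  rw [hnum, hden, mul_div_mul_comm]

/-- `f_σ(kα, kβ) = f_σ(α,β)^k` (everywhere). -/
theorem rayF_smul (k : ℕ) (t : Fin ℓ → ℝ) :
    rayF σ (fun i => (k : ℤ) * α i) (fun i => (k : ℤ) * β i) t = rayF σ α β t ^ k := by
  unfold rayF
  rw [num_ray, den_ray, div_pow]

/-! ### Submultiplicativity and homogeneity of the growth constant -/

/-- **Submultiplicativity**: `M_σ(α+α', β+β') ≤ M_σ(α,β) · M_σ(α',β')` when both ray functions are bounded on the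
simplex (injective `σ`). -/
theorem raySup_add_le (hσi : Function.Injective σ) (h1 : BddAbove (rayF σ α β '' openSimplex ℓ))
    (h2 : BddAbove (rayF σ α' β' '' openSimplex ℓ)) :
    raySup σ (fun i => α i + α' i) (fun i => β i + β' i) ≤ raySup σ α β * raySup σ α' β' := by
  have hM1 : ∀ t ∈ openSimplex ℓ, rayF σ α β t ≤ raySup σ α β := fun t ht => le_csSup h1 ⟨t, ht, rfl⟩
  have hM2 : ∀ t ∈ openSimplex ℓ, rayF σ α' β' t ≤ raySup σ α' β' := fun t ht => le_csSup h2 ⟨t, ht, rfl⟩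
  obtain ⟨t0, ht0⟩ := openSimplex_nonempty ℓ
  have hM1nn : 0 ≤ raySup σ α β := (rayF_pos σ α β hσi ht0).le.trans (hM1 t0 ht0)
  refine csSup_le ((openSimplex_nonempty ℓ).image _) ?_
  rintro _ ⟨t, ht, rfl⟩
  rw [rayF_add σ α β α' β' hσi ht]
  exact mul_le_mul (hM1 t ht) (hM2 t ht) (rayF_pos σ α' β' hσi ht).le hM1nn

/-- **Positive homogeneity**: `M_σ(kα, kβ) = M_σ(α,β)^k` for `k ≥ 1`, when the ray function is bounded on the simplex
(injective `σ`). -/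
theorem raySup_smul (hσi : Function.Injective σ) (hbdd : BddAbove (rayF σ α β '' openSimplex ℓ)) {k : ℕ}
    (hk : k ≠ 0) :
    raySup σ (fun i => (k : ℤ) * α i) (fun i => (k : ℤ) * β i) = raySup σ α β ^ k := by
  have hne := (openSimplex_nonempty ℓ).image (rayF σ (fun i => (k : ℤ) * α i) (fun i => (k : ℤ) * β i))
  obtain ⟨t0, ht0⟩ := openSimplex_nonempty ℓ
  have hM : ∀ t ∈ openSimplex ℓ, rayF σ α β t ≤ raySup σ α β := fun t ht => le_csSup hbdd ⟨t, ht, rfl⟩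
  have hMnn : 0 ≤ raySup σ α β := (rayF_pos σ α β hσi ht0).le.trans (hM t0 ht0)
  apply le_antisymm
  · -- `≤`: each value is `f^k ≤ M^k`
    refine csSup_le hne ?_
    rintro _ ⟨t, ht, rfl⟩
    rw [rayF_smul]
    exact pow_le_pow_left₀ (rayF_pos σ α β hσi ht).le (hM t ht) k
  · -- `≥`: `f = (f^k)^{1/k} ≤ S^{1/k}` pointwise, so `M ≤ S^{1/k}` and `M^k ≤ S`
    set S := raySup σ (fun i => (k : ℤ) * α i) (fun i => (k : ℤ) * β i) with hS
    have hbddk : BddAbove (rayF σ (fun i => (k : ℤ) * α i) (fun i => (k : ℤ) * β i) '' openSimplex ℓ) := by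
      refine ⟨raySup σ α β ^ k, ?_⟩
      rintro _ ⟨t, ht, rfl⟩
      rw [rayF_smul]
      exact pow_le_pow_left₀ (rayF_pos σ α β hσi ht).le (hM t ht) k
    have hSk : ∀ t ∈ openSimplex ℓ, rayF σ α β t ^ k ≤ S := fun t ht => by
      have := le_csSup hbddk ⟨t, ht, rfl⟩
      rwa [rayF_smul] at this
    have hSnn : 0 ≤ S := (pow_pos (rayF_pos σ α β hσi ht0) k).le.trans (hSk t0 ht0)
    have hroot : ∀ t ∈ openSimplex ℓ, rayF σ α β t ≤ S ^ ((k : ℝ)⁻¹) := fun t ht => by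
      have h := Real.rpow_le_rpow (pow_pos (rayF_pos σ α β hσi ht) k).le (hSk t ht)
        (inv_nonneg.2 (Nat.cast_nonneg k))
      rwa [Real.pow_rpow_inv_natCast (rayF_pos σ α β hσi ht).le hk] at h
    have hMle : raySup σ α β ≤ S ^ ((k : ℝ)⁻¹) :=
      csSup_le ((openSimplex_nonempty ℓ).image _) (by rintro _ ⟨t, ht, rfl⟩; exact hroot t ht)
    calc raySup σ α β ^ k ≤ (S ^ ((k : ℝ)⁻¹)) ^ k := pow_le_pow_left₀ hMnn hMle k
      _ = S := Real.rpow_inv_natCast_pow hSnn hk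

/-! ### Inside Brown's cone: the decay exponent is concave in the direction -/

section Cone

variable (hσ : Function.Bijective σ) (hh : Homogeneous σ α β) (hh' : Homogeneous σ α' β')
  (hray : ∀ N : ℤ, 0 ≤ N → BrownConvergent σ (fun i => N * α i) (fun i => N * β i))
  (hray' : ∀ N : ℤ, 0 ≤ N → BrownConvergent σ (fun i => N * α' i) (fun i => N * β' i))

include hσ hh hh' hray hray' in
/-- **`M_σ(α+α',β+β') ≤ M_σ(α,β) · M_σ(α',β')`** for two directions in Brown's cone. -/
theorem raySup_add_le_of_ray :
    raySup σ (fun i => α i + α' i) (fun i => β i + β' i) ≤ raySup σ α β * raySup σ α' β' :=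
  raySup_add_le σ α β α' β' hσ.1 (bddAbove_rayF_image σ α β hσ hh hray) (bddAbove_rayF_image σ α' β' hσ hh' hray')

include hσ hh hray in
/-- **`M_σ(kα,kβ) = M_σ(α,β)^k`** (`k ≥ 1`) for a direction in Brown's cone. -/
theorem raySup_smul_of_ray {k : ℕ} (hk : k ≠ 0) :
    raySup σ (fun i => (k : ℤ) * α i) (fun i => (k : ℤ) * β i) = raySup σ α β ^ k :=
  raySup_smul σ α β hσ.1 (bddAbove_rayF_image σ α β hσ hh hray) hk

include hσ hh hh' hray hray' in
/-- **Superadditivity of the decay exponent** `c_σ = −log M_σ` in the direction: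
`c_σ(α,β) + c_σ(α',β') ≤ c_σ(α+α', β+β')`, i.e. `−log M(α+α') ≥ −log M(α) − log M(α')`. -/
theorem decayExp_superadditive :
    -Real.log (raySup σ α β) + -Real.log (raySup σ α' β') ≤
      -Real.log (raySup σ (fun i => α i + α' i) (fun i => β i + β' i)) := by
  have h1 := raySup_pos σ α β hσ hh hray
  have h2 := raySup_pos σ α' β' hσ hh' hray'
  have hb1 := bddAbove_rayF_image σ α β hσ hh hray
  have hb2 := bddAbove_rayF_image σ α' β' hσ hh' hray'
  have hle := raySup_add_le σ α β α' β' hσ.1 hb1 hb2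
  -- positivity of the left constant: it dominates a positive value of the ray function
  obtain ⟨t0, ht0⟩ := openSimplex_nonempty ℓ
  have hbdd : BddAbove (rayF σ (fun i => α i + α' i) (fun i => β i + β' i) '' openSimplex ℓ) := by
    refine ⟨raySup σ α β * raySup σ α' β', ?_⟩
    rintro _ ⟨t, ht, rfl⟩
    rw [rayF_add σ α β α' β' hσ.1 ht]
    exact mul_le_mul (le_csSup hb1 ⟨t, ht, rfl⟩) (le_csSup hb2 ⟨t, ht, rfl⟩) (rayF_pos σ α' β' hσ.1 ht).le h1.le
  have h12 : 0 < raySup σ (fun i => α i + α' i) (fun i => β i + β' i) :=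
    (rayF_pos σ _ _ hσ.1 ht0).trans_le (le_csSup hbdd ⟨t0, ht0, rfl⟩)
  have hlog := Real.log_le_log h12 hle
  rw [Real.log_mul h1.ne' h2.ne'] at hlog
  linarith

include hσ hh hray in
/-- **Homogeneity of the decay exponent**: `c_σ(kα,kβ) = k · c_σ(α,β)` for `k ≥ 1`. -/
theorem decayExp_smul {k : ℕ} (hk : k ≠ 0) :
    -Real.log (raySup σ (fun i => (k : ℤ) * α i) (fun i => (k : ℤ) * β i)) = k * -Real.log (raySup σ α β) := by
  rw [raySup_smul_of_ray σ α β hσ hh hray hk, Real.log_pow]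
  ring

end Cone

end Summit.KontsevichZagierPeriods.Zeta5Search.Families.Cellular
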